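import Summits.RiemannHypothesis.RiemannHypothesis.Theorems.JensenPolynomialsCapCertCompute

/-!
# Route `JensenPolynomials` — crux children `XiCumulantMajorantCap` (stmt-RiemannHypothesis-19217) and
`XiCumulantMajorantCapFar` (stmt-RiemannHypothesis-19472): the UNIFORM TAIL `d ≥ D⋆`, part T1 — the certificate
(computation only; cell rh-jensen, engine seat g4; RH-FREE, γ-FREE)

The child says: for every `d ≥ 3` both all-plus majorant sums
`S₁(d) = Σ_{j≤d} (d)_j e_j ρ_winMin(d,j)` and `S₂(d) = Σ_{j≤d} (d)_j e_j (2/B_d)^j` of the caps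
`c_k = a(k)(k−1)!2^{k/2}M^{−(k−2)/2}`, `M = max(N, 2d³) + d` (`N = 10⁴`, resp. `2·10¹⁸` for the Far child), are `< 1`.
The per-degree kernel packaging (engine seat eng-2, `…CapCertCompute … CapCertSound`) gives the scaled frame
`ẽ_j = e_j(d/2)^{j/2}`, `b̃_k = c_k(d/2)^{k/2}/(k−1)!`, the recursion `jẽ_j = Σ_k b̃_k ẽ_{j−k}` and a per-degree checker.
The uniform tail proves the complement of every finite table AT ONCE — for all `d ≥ D⋆ = 100` simultaneously — from
bounds that are UNIFORM in `d` because only `M ≥ 2d³` is used: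

* `b̃₃ = (9/8)·d·x ≤ (9/8)/√2` (`(dx)² = d³/M ≤ 1/2`); for `k ≥ 4` the exact identity `b̃_k = (k/12)·d·(4x)^{k−2}` with
  `(4x)² = 16d/M ≤ 8/d²`, whence `b̃_k ≤ (k/12)·D⋆·(√8/D⋆)^{k−2}` (decreasing in `d`);
* scaled row weights `0, 1, √((4d−2)/d) ≤ 2, 3, (4d+10)/d, (5d²+30d+8)/d²`, window rows `(6/5)(j−1)P_j ≤ (6/5)(j−1)`,
  and ENERGY rows `√(dP_j) ≤ √d < √(4(j−2)³)` — an energy row at `j ≥ 7` MEANS `d < 4(j−2)³`, which is what makes it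
  `d`-free; every row `j ≥ 7` is `≤ 2^j`;
* `ẽ_j ≤ ẽ⁺_j` (`j ≤ Jt = 60`) by the monotone recursion on the uniform list (eng-2's `etTab` verbatim), and the
  `j`-tail `ẽ_j ≤ C·4^{−j}` for ALL `j` by strong induction, which closes because `G := Σ_k b̃⁺_k 4^k ≤ Jt + 1`;
* so `S₁(d) ≤ Σ_{j≤Jt} W⁺(j)ẽ⁺_j + C·2^{−Jt}` and `S₂(d) ≤ Σ_{j≤Jt} ẽ⁺_j + C·4^{−Jt}/3`.

This file (part T1) only DEFINES the `ℕ` fixed-point certificate `tailCheck : Bool` (unit `ONE = 2^96`, every operation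
rounded up, eng-2's primitives `cdiv/mulU/ofRatU/powU/sqrtU/etTab/BKof`), over generic data `(q, D, y, bts, T, J)` so that
the soundness parts T2–T4 never unfold a constant; part T5 evaluates it by `decide` (kernel, standard axioms; exact-integer
mirror at `D⋆ = 100`: `S₁⁺ = 0.9216`, `S₂⁺ = 0.3126`).  Elementary arithmetic on a fixed majorant series: nothing here is a
statement about `ξ` or `ζ`, and nothing here bears on the truth of RH.
-/

-- D-0017: `Summit.RiemannHypothesis.RiemannHypothesis.…` duplicates the namespace BY DESIGN (single-problem summit).
set_option linter.dupNamespace false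

open Finset

namespace Summit.RiemannHypothesis.RiemannHypothesis.Theorems.JensenPolynomials.CapCert

/-! ## The uniform certificate (computable; a natural `n` stands for `n / ONE`, `ONE = 2^96`) -/

/-- Tail threshold `D⋆`: every bound below holds for all `d ≥ D⋆` at once. -/
def Dstar : ℕ := 100
/-- `j`-cut of the uniform certificate. -/
def Jt : ℕ := 60
/-- Upper fixed point of `1/√2`. -/
def isq2U : ℕ := sqrtU (ofRatU 1 2)
/-- Upper fixed point of `y⋆ = √8/D⋆` (`4x_d ≤ √8/d ≤ y⋆` for `d ≥ D⋆`). -/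
def yT : ℕ := sqrtU (ofRatU 8 (Dstar ^ 2))
/-- The uniform memo list `[b̃⁺_3, …, b̃⁺_KK]` built from an upper fixed point `q ≥ 1/√2`, a threshold `D` and `y ≥ √8/D`:
`b̃⁺_3 = ⌈9q/8⌉`, `b̃⁺_k = ⌈k·D·y^{k−2}/12⌉` (`k ≥ 4`). -/
def btsOf (q D y : ℕ) : List ℕ :=
  (List.range (KK - 2)).map (fun i => if i = 0 then cdiv (9 * q) 8 else cdiv ((i + 3) * D * powU y (i + 1)) 12)
/-- Upward fixed point of the ratio `(KK+2)/(KK+1)·y`. -/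
def ypOfT (y : ℕ) : ℕ := cdiv ((KK + 2) * y) (KK + 1)
/-- Uniform `k`-tail `T ≥ Σ_{k>KK} b̃_k`: `(D(KK+1)/12)·y^{KK−1}/(1 − y')`. -/
def TOf (D y : ℕ) : ℕ := cdiv (ofRatU (D * (KK + 1)) 12 * powU y (KK - 1)) (ONE - ypOfT y)
/-- `G⁺ ≥ Σ_{k≥3} b̃⁺_k 4^k`: head `k ≤ KK` from the list plus the geometric tail in `z = 4y`. -/
def GOf (bts : List ℕ) (D y : ℕ) : ℕ :=
  (∑ i ∈ range KK, (if 2 ≤ i then bts.getD (i - 2) 0 * 4 ^ (i + 1) else 0))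
    + cdiv (ofRatU (16 * D * (KK + 1)) 12 * powU (4 * y) (KK - 1)) (ONE - ypOfT (4 * y))
/-- `C⁺ = max_{j ≤ J} ẽ⁺_j·4^j` read off a reversed table `[ẽ⁺_J, …, ẽ⁺_0]`. -/
def COf (ets : List ℕ) (J : ℕ) : ℕ := lmax ((List.range (J + 1)).map (fun j => ets.getD (J - j) 0 * 4 ^ j))
/-- Uniform upper fixed point of the scaled row weight `W₁(j)` for all `d ≥ D` (`D ≥ 9`). -/
def wOf (D j : ℕ) : ℕ :=
  if j ≤ 1 then 0
  else if j = 2 then ONE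
  else if j = 3 then 2 * ONE
  else if j = 4 then 3 * ONE
  else if j = 5 then ofRatU (4 * D + 10) D
  else if j = 6 then ofRatU (5 * D ^ 2 + 30 * D + 8) (D ^ 2)
  else if 4 * (j - 2) ^ 3 ≤ D then cdiv (6 * (j - 1) * ONE) 5
  else max (cdiv (6 * (j - 1) * ONE) 5) (sqrtU (4 * (j - 2) ^ 3 * ONE))
/-- Head of the first sum, `Σ_{j=1}^{J} W⁺(j)·ẽ⁺_j`. -/
def S1Of (ets : List ℕ) (D J : ℕ) : ℕ := ∑ j ∈ range J, mulU (wOf D (j + 1)) (ets.getD (J - (j + 1)) 0)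
/-- Head of the second sum, `Σ_{j=1}^{J} ẽ⁺_j`. -/
def S2Of (ets : List ℕ) (J : ℕ) : ℕ := ∑ j ∈ range J, ets.getD (J - (j + 1)) 0

/-- The uniform list at the certificate's constants. -/
def btsT : List ℕ := btsOf isq2U Dstar yT
/-- The uniform `k`-tail at the certificate's constants. -/
def TT : ℕ := TOf Dstar yT
/-- **THE UNIFORM TAIL CHECK** (one evaluation; run in part T5): the table `ets = [ẽ⁺_Jt, …, ẽ⁺_0]` is
eng-2's `etTab` on the uniform list, `C = C⁺`, `G = G⁺`. -/
def tailCheck : Bool :=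
  let ets := etTab btsT TT Jt
  let C := COf ets Jt
  let G := GOf btsT Dstar yT
  decide (ypOfT yT < ONE) && decide (ypOfT (4 * yT) < ONE)
    && decide (BKof btsT + TT ≤ 3 * ONE) && decide (G ≤ (Jt + 1) * ONE)
    && decide (S1Of ets Dstar Jt + cdiv C (2 ^ Jt) < ONE) && decide (S2Of ets Jt + cdiv C (3 * 4 ^ Jt) < ONE)

end Summit.RiemannHypothesis.RiemannHypothesis.Theorems.JensenPolynomials.CapCert
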